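import Summits.AnomalousDissipation.Statement

/-!
# Route `LandauJetArena`, crux `JetPairZerothLaw` (stmt-AnomalousDissipation-1540): glue of the strategist's split
# (FRAME FORM — importable by the route module)

`jetPairZerothLaw_of_pieces` is the implication `JetPairWorkFloor → JetPairNoLeakFamily → JetPairZerothLaw`
with all three statements INLINED VERBATIM (the two children exactly as filed in `children.json`; the crux
body copied from `Theses/LandauJetArena.lean` rev 2), so that this module does NOT import the route module
and the gate may render `theorem JetPairZerothLawGlueBy_holds : JetPairWorkFloor → JetPairNoLeakFamily →
JetPairZerothLaw := _root_.Summit.AnomalousDissipation.AnomalousDissipation.Theorems.jetPairZerothLaw_of_pieces`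
inside the route file (`route edit --split … --glue-by`), the link typechecking by `δ`-unfolding only.
The same glue stated against the route decl BY NAME, together with the positioning theorems
`JetPairDissipationFloor → JetPairWorkFloor` and `JetPairZerothLawZM → JetPairNoLeakFamily`, is kernel-checked
in `Cruxes/JetPairZerothLaw/SeamByName.lean`.

Pieces (crux-strategist seam "input power × no leak", 2026-08-17):
* child 1 `JetPairWorkFloor` (∀): every zero-momentum, energy-`≤ E`, small-viscosity global Leray–Hopf
  solution driven by a jet-pair force receives limsup-mean input power `⟨∫⟪f,u⟫⟩ ≥ ε(f, E) > 0`;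
* child 2 `JetPairNoLeakFamily` (∃): some jet-pair force admits a vanishing-viscosity family of global
  Leray–Hopf solutions from zero-momentum data with bounded limsup-mean energy whose resolved dissipation
  keeps a fixed fraction `θ > 0` of the input power.
Proof: reindex the family past `ν₀(E)` (`Tendsto ν atTop (𝓝 0)`), then `θ ε ≤ θ·power ≤ dissipation`.
No definitions, nothing conditional, no analysis. A prover may land this file verbatim as
`Summits/AnomalousDissipation/AnomalousDissipation/Theorems/LandauJetArenaJetPairZerothLawSplit.lean`.
-/

namespace Summit.AnomalousDissipation.AnomalousDissipation.Theorems

-- the mandated namespace `Summit.<Summit>.<Problem>.Theorems` repeats `AnomalousDissipation` (single-problem summit)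
set_option linter.dupNamespace false

open Filter Topology

/-- **Glue of the split of `LandauJetArena.JetPairZerothLaw`** (crux-strategist, 2026-08-17).
Hypotheses, in order: (1) the input-power floor at zero momentum for every jet-pair force and every energy
level (child `JetPairWorkFloor`, verbatim); (2) a bounded-energy zero-momentum no-leak vanishing-viscosity
family for some jet-pair force (child `JetPairNoLeakFamily`, verbatim); conclusion: the crux body
(`JetPairZerothLaw`, verbatim). Take the configuration, `E`, `θ` and the family from (2); (1) at that
configuration and `E` gives `ε, ν₀ > 0`; `ν j → 0` gives `J` with `ν j ≤ ν₀` for `j ≥ J`; the reindexed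
family `j ↦ j + J` has energies `≤ E` and dissipation `≥ θ ε`. [folklore] -/
theorem jetPairZerothLaw_of_pieces
    (hFloor : ∀ (ρ : ℝ) (a : UnitAddTorus (Fin 3)) (φ : UnitAddTorus (Fin 3) → ℝ) (f : UnitAddTorus (Fin 3) → EuclideanSpace ℝ (Fin 3)), (0 < ρ ∧ 4 * ρ < ‖a + a‖ ∧ Literature.Analysis.FunctionSpaces.Torus.IsSmooth φ ∧ (∀ x, 0 ≤ φ x) ∧ (∀ x : UnitAddTorus (Fin 3), ρ ≤ ‖x‖ → φ x = 0) ∧ MeasureTheory.integral MeasureTheory.volume (fun x => φ x) = 1 ∧ Literature.Analysis.FunctionSpaces.Torus.IsSmooth f ∧ Literature.Analysis.FunctionSpaces.Torus.IsDivFree f ∧ Literature.Analysis.FunctionSpaces.Torus.HasZeroMean f ∧ (∀ w : UnitAddTorus (Fin 3) → EuclideanSpace ℝ (Fin 3), Literature.Analysis.FunctionSpaces.Torus.IsSmooth w → Literature.Analysis.FunctionSpaces.Torus.IsDivFree w → MeasureTheory.integral MeasureTheory.volume (fun x => inner ℝ (f x) (w x)) = MeasureTheory.integral MeasureTheory.volume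 (fun x => (φ (x - a) - φ (x + a)) * inner ℝ (w x) (EuclideanSpace.single (2 : Fin 3) (1 : ℝ) : EuclideanSpace ℝ (Fin 3))))) → ∀ E : ℝ, ∃ ε : ℝ, 0 < ε ∧ ∃ ν₀ : ℝ, 0 < ν₀ ∧ ∀ (ν : ℝ) (u₀ : UnitAddTorus (Fin 3) → EuclideanSpace ℝ (Fin 3)) (u : ℝ → UnitAddTorus (Fin 3) → EuclideanSpace ℝ (Fin 3)), 0 < ν → ν ≤ ν₀ → Literature.Analysis.FunctionSpaces.Torus.HasZeroMean u₀ → Literature.Analysis.FluidPDE.Torus.IsGlobalLerayHopf ν (fun _ => f) u₀ u → Literature.Analysis.FluidPDE.meanEnergy u ≤ E → ε ≤ Literature.Analysis.FluidPDE.longTimeAvgSup (fun t => MeasureTheory.integral MeasureTheory.volume (fun x => inner ℝ (f x) (u t x))))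
    (hFam : ∃ (ρ : ℝ) (a : UnitAddTorus (Fin 3)) (φ : UnitAddTorus (Fin 3) → ℝ) (f : UnitAddTorus (Fin 3) → EuclideanSpace ℝ (Fin 3)), (0 < ρ ∧ 4 * ρ < ‖a + a‖ ∧ Literature.Analysis.FunctionSpaces.Torus.IsSmooth φ ∧ (∀ x, 0 ≤ φ x) ∧ (∀ x : UnitAddTorus (Fin 3), ρ ≤ ‖x‖ → φ x = 0) ∧ MeasureTheory.integral MeasureTheory.volume (fun x => φ x) = 1 ∧ Literature.Analysis.FunctionSpaces.Torus.IsSmooth f ∧ Literature.Analysis.FunctionSpaces.Torus.IsDivFree f ∧ Literature.Analysis.FunctionSpaces.Torus.HasZeroMean f ∧ (∀ w : UnitAddTorus (Fin 3) → EuclideanSpace ℝ (Fin 3), Literature.Analysis.FunctionSpaces.Torus.IsSmooth w → Literature.Analysis.FunctionSpaces.Torus.IsDivFree w → MeasureTheory.integral MeasureTheory.volume (fun x => inner ℝ (f x) (w x)) = MeasureTheory.integral MeasureTheory.volume (fun x => (φ (x - a) - φ (x + a)) * inner ℝ (w x) (EuclideanSpace.single (2 : Fin 3) (1 : ℝ)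 : EuclideanSpace ℝ (Fin 3))))) ∧ ∃ (E θ : ℝ) (ν : ℕ → ℝ) (u₀ : ℕ → UnitAddTorus (Fin 3) → EuclideanSpace ℝ (Fin 3)) (u : ℕ → ℝ → UnitAddTorus (Fin 3) → EuclideanSpace ℝ (Fin 3)), 0 < θ ∧ (∀ j, 0 < ν j) ∧ Filter.Tendsto ν Filter.atTop (nhds 0) ∧ (∀ j, Literature.Analysis.FunctionSpaces.Torus.HasZeroMean (u₀ j)) ∧ (∀ j, Literature.Analysis.FluidPDE.Torus.IsGlobalLerayHopf (ν j) (fun _ => f) (u₀ j) (u j)) ∧ (∀ j, Literature.Analysis.FluidPDE.meanEnergy (u j) ≤ E) ∧ ∀ j, θ * Literature.Analysis.FluidPDE.longTimeAvgSup (fun t => MeasureTheory.integral MeasureTheory.volume (fun x => inner ℝ (f x) (u j t x))) ≤ Literature.Analysis.FluidPDE.meanDissipation (ν j) (u j)) :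
    ∃ (ρ : ℝ) (a : UnitAddTorus (Fin 3)) (φ : UnitAddTorus (Fin 3) → ℝ) (f : UnitAddTorus (Fin 3) → EuclideanSpace ℝ (Fin 3)), (0 < ρ ∧ 4 * ρ < ‖a + a‖ ∧ Literature.Analysis.FunctionSpaces.Torus.IsSmooth φ ∧ (∀ x, 0 ≤ φ x) ∧ (∀ x : UnitAddTorus (Fin 3), ρ ≤ ‖x‖ → φ x = 0) ∧ MeasureTheory.integral MeasureTheory.volume (fun x => φ x) = 1 ∧ Literature.Analysis.FunctionSpaces.Torus.IsSmooth f ∧ Literature.Analysis.FunctionSpaces.Torus.IsDivFree f ∧ Literature.Analysis.FunctionSpaces.Torus.HasZeroMean f ∧ (∀ w : UnitAddTorus (Fin 3) → EuclideanSpace ℝ (Fin 3), Literature.Analysis.FunctionSpaces.Torus.IsSmooth w → Literature.Analysis.FunctionSpaces.Torus.IsDivFree w → MeasureTheory.integral MeasureTheory.volume (fun x => inner ℝ (f x) (w x)) = MeasureTheory.integral MeasureTheory.volume (fun x => (φ (x - a) - φ (x + a)) * inner ℝ (w x) (EuclideanSpace.single (2 : Fin 3) (1 : ℝ) : EuclideanSpace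 ℝ (Fin 3))))) ∧ ∃ (ν : ℕ → ℝ) (u₀ : ℕ → UnitAddTorus (Fin 3) → EuclideanSpace ℝ (Fin 3)) (u : ℕ → ℝ → UnitAddTorus (Fin 3) → EuclideanSpace ℝ (Fin 3)), (∀ j, 0 < ν j) ∧ Filter.Tendsto ν Filter.atTop (nhds 0) ∧ (∀ j, Literature.Analysis.FluidPDE.Torus.IsGlobalLerayHopf (ν j) (fun _ => f) (u₀ j) (u j)) ∧ (∃ E : ℝ, ∀ j, Literature.Analysis.FluidPDE.meanEnergy (u j) ≤ E) ∧ ∃ ε : ℝ, 0 < ε ∧ ∀ j, ε ≤ Literature.Analysis.FluidPDE.meanDissipation (ν j) (u j) := by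
  obtain ⟨ρ, a, φ, f, hcfg, E, θ, ν, u₀, u, hθ, hν, hT, hzm, hLH, hE, hNL⟩ := hFam
  obtain ⟨ε, hε, ν₀, hν₀, hfl⟩ := hFloor ρ a φ f hcfg E
  obtain ⟨J, hJ⟩ := eventually_atTop.1 (hT.eventually (Iic_mem_nhds hν₀))
  refine ⟨ρ, a, φ, f, hcfg, fun j => ν (j + J), fun j => u₀ (j + J), fun j => u (j + J),
    fun j => hν (j + J), hT.comp (tendsto_add_atTop_nat J), fun j => hLH (j + J),
    ⟨E, fun j => hE (j + J)⟩, θ * ε, mul_pos hθ hε, fun j => ?_⟩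
  have hw : ε ≤ Literature.Analysis.FluidPDE.longTimeAvgSup
      (fun t => MeasureTheory.integral MeasureTheory.volume (fun x => inner ℝ (f x) (u (j + J) t x))) :=
    hfl (ν (j + J)) (u₀ (j + J)) (u (j + J)) (hν (j + J)) (hJ (j + J) (Nat.le_add_left J j))
      (hzm (j + J)) (hLH (j + J)) (hE (j + J))
  calc θ * ε ≤ θ * Literature.Analysis.FluidPDE.longTimeAvgSup
        (fun t => MeasureTheory.integral MeasureTheory.volume (fun x => inner ℝ (f x) (u (j + J) t x))) :=
        mul_le_mul_of_nonneg_left hw hθ.le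
    _ ≤ Literature.Analysis.FluidPDE.meanDissipation (ν (j + J)) (u (j + J)) := hNL (j + J)

end Summit.AnomalousDissipation.AnomalousDissipation.Theorems
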